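import Literature.Geometry.Lorentzian.KerrSchildMultiplierCurrent
import Literature.Geometry.Lorentzian.MinkowskiRadialMultiplier
import Literature.Geometry.Lorentzian.KerrConvergence
import Summits.FinalStateConjecture.FinalStateConjecture.Theorems.ClusterCompletenessAdiabaticMultiKerrILEDField

/-! # Route ClusterCompleteness — crux `AdiabaticMultiKerrILED`: locality of the patched field
# and the offset-defect bound

Helper file for the crux `stmt-FinalStateConjecture-14310` (line `Sketch`, lead c6 wave 1, card
milne-hubble-current): two bricks about the patched coefficient field
`G = η − Σⱼ χⱼ · 2Hⱼ(qⱼ x) · (Λⱼℓ♯ⱼ(qⱼ x)) ⊗ (Λⱼℓ♯ⱼ(qⱼ x))`, `χⱼ = smoothTransition (2 − rⱼ/8Mⱼ)`: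
* `abs_sum_directionalDeriv_quadratic_le` — if every directional derivative `∂_e F^{αβ}(x)` is
  bounded by `D`, then `|Σ_{αβ} ∂_e F^{αβ} P_α P_β| ≤ 4 D Σ_κ P_κ²` (AM–GM on each of the sixteen
  terms: `|P_α P_β| ≤ (P_α² + P_β²)/2`, and `Σ_{αβ} (P_α² + P_β²)/2 = 4 Σ_κ P_κ²`);
* `cruxField_eventuallyEq_single` — at a point `x` where every other hole `j ≠ i` is far
  (`16Mⱼ < rⱼ(qⱼ x)`), the same strict inequalities hold on a neighbourhood of `x` (continuity of
  `y ↦ rⱼ(qⱼ y)`, finitely many `j`), every cut-off `χⱼ`, `j ≠ i`, vanishes there, and so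
  `G^{μν} = η^{μν} − χᵢ · 2Hᵢ · (Λᵢℓ♯ᵢ)^μ (Λᵢℓ♯ᵢ)^ν` eventually near `x` (as germs at `x`).
[folklore] -/

noncomputable section

-- the doubled `FinalStateConjecture.FinalStateConjecture` path component trips dupNamespace
set_option linter.dupNamespace false

open scoped BigOperators Topology
open Filter Literature.Geometry.Lorentzian

namespace Summit.FinalStateConjecture.FinalStateConjecture.Theorems

/-! ### The offset-defect bound -/

/-- AM–GM for one term of the quadratic form: `|f P_α P_β| ≤ D (P_α² + P_β²)/2` whenever
`|f| ≤ D`. [folklore] -/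
theorem fieldLoc_abs_mul_mul_le {f D : ℝ} (hf : |f| ≤ D) (u v : ℝ) :
    |f * u * v| ≤ D * ((u ^ 2 + v ^ 2) / 2) := by
  rw [mul_assoc, abs_mul]
  have h1 : |u * v| ≤ (u ^ 2 + v ^ 2) / 2 := by
    rw [abs_mul]
    linarith [two_mul_le_add_sq |u| |v|, sq_abs u, sq_abs v]
  exact mul_le_mul hf h1 (abs_nonneg _) ((abs_nonneg _).trans hf)

/-- **Offset-defect bound.** If every directional derivative `∂_e F^{αβ}(x)` (`α, β < 4`) is
bounded in absolute value by `D`, then the quadratic form `Σ_{αβ} ∂_e F^{αβ}(x) P_α P_β` is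
bounded by `4 D Σ_κ P_κ²`: termwise AM–GM `|P_α P_β| ≤ (P_α² + P_β²)/2` and
`Σ_{α,β<4} (P_α² + P_β²)/2 = 4 Σ_κ P_κ²`. [folklore] -/
theorem abs_sum_directionalDeriv_quadratic_le : ∀ (F : E4 → Fin 4 → Fin 4 → ℝ) (x e : E4) (P : Fin 4 → ℝ) (D : ℝ) (hD : ∀ α β, |fderiv ℝ (fun y ↦ F y α β) x e| ≤ D), |∑ α, ∑ β, fderiv ℝ (fun y ↦ F y α β) x e * P α * P β| ≤ 4 * D * ∑ κ, P κ ^ 2 := by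
  intro F x e P D hD
  calc |∑ α, ∑ β, fderiv ℝ (fun y ↦ F y α β) x e * P α * P β|
      ≤ ∑ α, |∑ β, fderiv ℝ (fun y ↦ F y α β) x e * P α * P β| :=
        Finset.abs_sum_le_sum_abs _ _
    _ ≤ ∑ α, ∑ β, |fderiv ℝ (fun y ↦ F y α β) x e * P α * P β| :=
        Finset.sum_le_sum fun α _ ↦ Finset.abs_sum_le_sum_abs _ _
    _ ≤ ∑ α, ∑ β, D * ((P α ^ 2 + P β ^ 2) / 2) :=
        Finset.sum_le_sum fun α _ ↦ Finset.sum_le_sum fun β _ ↦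
          fieldLoc_abs_mul_mul_le (hD α β) (P α) (P β)
    _ = 4 * D * ∑ κ, P κ ^ 2 := by
        simp only [Fin.sum_univ_four]
        ring

/-! ### Locality of the patched field near one hole -/

/-- Under the crux hypothesis `qⱼ = poincareInv Λⱼ (0, pⱼ)` every rest-frame radius
`y ↦ rⱼ(qⱼ y)` is continuous on the lab frame (`Kerr.radius` is continuous and `qⱼ` is a
continuous affine map). [folklore] -/
theorem fieldLoc_continuous_radius_comp {N : ℕ} (a : Fin N → ℝ) (Λ : Fin N → lorentzGroup)
    (p : Fin N → E3) (q : Fin N → E4 → E4)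
    (hq : ∀ i x, q i x = poincareInv (Λ i) (E4.ofTimeSpace 0 (p i)) x) (j : Fin N) :
    Continuous fun y ↦ Kerr.radius (a j) (q j y) := by
  simp only [hq]
  exact (Kerr.continuous_radius (a j)).comp (continuous_poincareInv _ _)

/-- **Openness of the far condition.** If at `x` every hole `j ≠ i` is far,
`16Mⱼ < rⱼ(qⱼ x)`, then the same strict inequalities hold for all `y` near `x`: each set
`{y | 16Mⱼ < rⱼ(qⱼ y)}` is open (continuity of `y ↦ rⱼ(qⱼ y)`) and there are finitely many `j`.
[folklore] -/
theorem fieldLoc_eventually_far {N : ℕ} (M a : Fin N → ℝ) (Λ : Fin N → lorentzGroup)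
    (p : Fin N → E3) (q : Fin N → E4 → E4)
    (hq : ∀ i x, q i x = poincareInv (Λ i) (E4.ofTimeSpace 0 (p i)) x) (i : Fin N) (x : E4)
    (hfar : ∀ j, j ≠ i → 16 * M j < Kerr.radius (a j) (q j x)) :
    ∀ᶠ y in 𝓝 x, ∀ j, j ≠ i → 16 * M j < Kerr.radius (a j) (q j y) := by
  rw [Filter.eventually_all]
  intro j
  by_cases hji : j = i
  · exact Filter.Eventually.of_forall fun y h ↦ absurd hji h
  · have hopen : IsOpen {y | 16 * M j < Kerr.radius (a j) (q j y)} :=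
      isOpen_lt continuous_const (fieldLoc_continuous_radius_comp a Λ p q hq j)
    filter_upwards [hopen.mem_nhds (hfar j hji)] with y hy
    exact fun _ ↦ hy

/-- **Locality of the patched field near hole `i`.** Under the crux hypotheses (`qⱼ` the
rest-frame maps, `Mⱼ > 0`, `G = η − Σⱼ χⱼ · 2Hⱼ · (Λⱼℓ♯ⱼ) ⊗ (Λⱼℓ♯ⱼ)`), at a point `x` where every
other hole `j ≠ i` is far (`16Mⱼ < rⱼ(qⱼ x)`) the far condition persists on a neighbourhood of
`x` (`fieldLoc_eventually_far`), every cut-off `χⱼ = smoothTransition (2 − rⱼ/8Mⱼ)` with `j ≠ i`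
vanishes there (`cruxCutoff_eq_zero`), the sum collapses to its `i`-th term and
`η(∂_μ, ∂_ν) = η_{μν}`: as germs at `x`,
`G^{μν} = η^{μν} − χᵢ · 2Hᵢ(qᵢ ·) · (Λᵢℓ♯ᵢ(qᵢ ·))^μ (Λᵢℓ♯ᵢ(qᵢ ·))^ν`. [folklore] -/
theorem cruxField_eventuallyEq_single : ∀ {N : ℕ} (M a : Fin N → ℝ) (Λ : Fin N → lorentzGroup) (p : Fin N → E3) (q : Fin N → E4 → E4) (G : E4 → Fin 4 → Fin 4 → ℝ) (hq : ∀ i x, q i x = poincareInv (Λ i) (E4.ofTimeSpace 0 (p i)) x) (hM : ∀ i, 0 < M i) (hG : ∀ x μ ν, G x μ ν = Minkowski.bilin (E4.basisVector μ) (E4.basisVector ν) - ∑ i, Real.smoothTransition (2 - Kerr.radius (a i) (q i x) / (8 * M i)) * (2 * Kerr.scalarH (M i) (a i) (q i x)) * ((Λ i : E4 ≃L[ℝ] E4) (Kerr.nullVector (a i) (q i x))) μ * ((Λ i : E4 ≃L[ℝ] E4) (Kerr.nullVector (a i) (q i x))) ν) (i : Fin N) (x : E4) (hfar : ∀ j,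 j ≠ i → 16 * M j < Kerr.radius (a j) (q j x)) (μ ν : Fin 4), (fun y ↦ G y μ ν) =ᶠ[𝓝 x] fun y ↦ Kerr.etaComp μ ν - Real.smoothTransition (2 - Kerr.radius (a i) (q i y) / (8 * M i)) * (2 * Kerr.scalarH (M i) (a i) (q i y)) * ((Λ i : E4 ≃L[ℝ] E4) (Kerr.nullVector (a i) (q i y))) μ * ((Λ i : E4 ≃L[ℝ] E4) (Kerr.nullVector (a i) (q i y))) ν := by
  intro N M a Λ p q G hq hM hG i x hfar μ ν
  filter_upwards [fieldLoc_eventually_far M a Λ p q hq i x hfar] with y hy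
  rw [hG, Kerr.minkowski_bilin_basisVector, Finset.sum_eq_single i]
  · intro j _ hji
    rw [cruxCutoff_eq_zero (hM j) (hy j hji).le]
    ring
  · intro hni
    exact absurd (Finset.mem_univ i) hni

end Summit.FinalStateConjecture.FinalStateConjecture.Theorems

end
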